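import Summits.CriticalPhenomena.PercolationContinuityZ3.Theorems.PercNearOneGluingNoHeavyLowerTailThresholdRABThreePartition
import Summits.CriticalPhenomena.PercolationContinuityZ3.Theorems.PercNearOneGluingNoHeavyLowerTailThresholdRABCondThree

/-!
# `NoHeavyLowerTail` (crux stmt-CriticalPhenomena-4575), lane prim-ineq-gen-4 (gen 18): **three-partition positivity with the threshold slot
# `Θ₃ = {T : 3 ≤ |T|}` in EVERY dimension ≥ 15, unconditionally**

Support file (`--supports stmt-CriticalPhenomena-4575`; memo `run/shared/lean/prim/prim-ineq-gen-4/PROOFS-RAB-ALL-K-g18.md` Theorem 3 / §8b).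
Pure proof, no definitions, no `sorry`, standard axioms: the general threshold theorem `threePartN_threshold_nonneg_of_numeric` (every `k`,
under the numeric counting condition) composed with `ThresholdRAB.cond_three_numeric` (the condition for `k = 3` holds for all `n ≥ 15`).
(Gen 17: `k = 2`, all dimensions `≥ 4`.  Dimensions `≤ 6` for `k = 3` are covered by the lane's exhaustive censuses; `7` by the kit census of gen 18;
`8 ≤ n ≤ 14` remain outside this certificate — see the memo §6.)
-/

noncomputable section

open Finset
open scoped Classical

namespace Summit.CriticalPhenomena.PercolationContinuityZ3.Theorems.ThreePartition

variable {ι : Type*} [Fintype ι]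

/-- **`N(Θ₃, V, W) ≥ 0` for all up-sets `V, W` on every finite ground set with at least `15` points.** [this work] -/
theorem threePartN_thresholdThree_nonneg [DecidableEq ι] (hι : 15 ≤ Fintype.card ι) (V W : Set (Set ι))
    (hV : IsUpperSet V) (hW : IsUpperSet W) : 0 ≤ threePartN {T : Set ι | 3 ≤ T.ncard} V W :=
  threePartN_threshold_nonneg_of_numeric 3 (ThresholdRAB.cond_three_numeric _ hι) V W hV hW

end Summit.CriticalPhenomena.PercolationContinuityZ3.Theorems.ThreePartition

end
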